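import Mathlib
import Summits.Ventures.PercRepro2.Defs
import Summits.Ventures.PercRepro2.Independence
import Summits.Ventures.PercRepro2.Harris
import Summits.Ventures.PercRepro2.Graph
import Summits.Ventures.PercRepro2.Events
import Summits.Ventures.PercRepro2.ZCTwoEdge
import Summits.Ventures.PercRepro2.ZCLeafReductionsGraph

/-!
# Zero-weight edges are invisible, and the leaf lemmas in pointwise form
(blind cell PercRepro2, mine-a g23; MINE-A.md §70.6)

Two pieces of plumbing for iterating the leaf reductions of (ZC) inside one fixed edge type `E`
(the reduced statement lives under `p[f ↦ 0]`, so the next leaf is a leaf of the POSITIVE-weight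
subgraph only):
* `Z.piecewise (fun _ => false) ω` closes every edge of a finite set `Z`; if `p e = 0` on `Z` then
  every event has the same probability as its pull-back (`prob_eq_closeSet`): zero-weight edges may
  be assumed closed.
* The structural leaf lemmas of `ZCLeafReductionsGraph` in POINTWISE form: the hypothesis
  «`f` is the only edge at `ℓ`» is replaced by «in `ω`, every edge at `ℓ` other than `f` is closed»
  (`cluster_leaf_eq'`, `conn_leaf_iff_of_ne'`, `conn_leaf_iff'`, `cluster_leaf_closed'`).
One seat.
-/

namespace Summit.Ventures.PercRepro2

section CloseSet

variable {E : Type*} [DecidableEq E]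

/-- The configuration with every edge of the finite set `Z` closed is `Z.piecewise (fun _ => false) ω`:
an edge of `Z` is closed in it. -/
lemma closeSet_apply_of_mem (Z : Finset E) (ω : Config E) {e : E} (h : e ∈ Z) :
    Z.piecewise (fun _ => false) ω e = false := Finset.piecewise_eq_of_mem _ _ _ h

/-- An edge outside `Z` keeps its state. -/
lemma closeSet_apply_of_not_mem (Z : Finset E) (ω : Config E) {e : E} (h : e ∉ Z) :
    Z.piecewise (fun _ => false) ω e = ω e := Finset.piecewise_eq_of_notMem _ _ _ h

/-- `closeSet Z ω ≤ ω`. -/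
lemma closeSet_le (Z : Finset E) (ω : Config E) : Z.piecewise (fun _ => false) ω ≤ ω := by
  intro e
  by_cases h : e ∈ Z
  · rw [closeSet_apply_of_mem Z ω h]; exact Bool.false_le _
  · rw [closeSet_apply_of_not_mem Z ω h]

/-- Closing `Z` is monotone. -/
lemma closeSet_mono (Z : Finset E) {ω ω' : Config E} (h : ω ≤ ω') :
    Z.piecewise (fun _ => false) ω ≤ Z.piecewise (fun _ => false) ω' := by
  intro e
  by_cases he : e ∈ Z
  · rw [closeSet_apply_of_mem Z ω he]; exact Bool.false_le _
  · rw [closeSet_apply_of_not_mem Z ω he, closeSet_apply_of_not_mem Z ω' he]; exact h e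

/-- Closing `Z` commutes with forcing an edge outside `Z`. -/
lemma closeSet_update (Z : Finset E) {f : E} (hf : f ∉ Z) (ω : Config E) (b : Bool) :
    Z.piecewise (fun _ => false) (Function.update ω f b)
      = Function.update (Z.piecewise (fun _ => false) ω) f b := by
  funext e
  by_cases hef : e = f
  · subst hef; simp [Finset.piecewise, hf]
  · by_cases he : e ∈ Z
    · simp [Finset.piecewise, he, Function.update_of_ne hef]
    · simp [Finset.piecewise, he, Function.update_of_ne hef]

/-- `closeSet (insert e Z) ω = closeSet Z (ω[e ↦ closed])`. -/
lemma closeSet_insert (Z : Finset E) (e : E) (ω : Config E) :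
    (insert e Z).piecewise (fun _ => false) ω
      = Z.piecewise (fun _ => false) (Function.update ω e false) := by
  funext e'
  by_cases h : e' = e
  · subst h; simp [Finset.piecewise]
  · by_cases hZ : e' ∈ Z
    · simp [Finset.piecewise, hZ, h]
    · simp [Finset.piecewise, hZ, h]

end CloseSet

section ZeroWeight

variable {E : Type*} [Fintype E] [DecidableEq E] {R : Type*} [CommRing R]

/-- A zero-weight edge may be assumed closed: `P(A) = P(ω[e ↦ closed] ∈ A)` when `p e = 0`. -/
lemma prob_eq_closeOne_of_zero (p : E → R) {e : E} (he : p e = 0) (A : Set (Config E)) :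
    prob p A = prob p {ω | Function.update ω e false ∈ A} := by
  have h := prob_update_zero_eq_shift p e A
  rwa [← he, Function.update_eq_self] at h

/-- Zero-weight edges may be assumed closed: `P(A) = P(Z.piecewise (fun _ => false) ω ∈ A)` when
`p = 0` on `Z`. -/
lemma prob_eq_closeSet (p : E → R) (Z : Finset E) (hZ : ∀ e ∈ Z, p e = 0) (A : Set (Config E)) :
    prob p A = prob p {ω | Z.piecewise (fun _ => false) ω ∈ A} := by
  induction Z using Finset.induction_on with
  | empty => simp [Finset.piecewise_empty]
  | insert e Z he ih =>
    have he0 : p e = 0 := hZ e (Finset.mem_insert_self e Z)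
    have hZ' : ∀ e' ∈ Z, p e' = 0 := fun e' h => hZ e' (Finset.mem_insert_of_mem h)
    rw [ih hZ', prob_eq_closeOne_of_zero p he0]
    congr 1
    ext ω
    simp only [Set.mem_setOf_eq, closeSet_insert]

end ZeroWeight

section LeafPointwise

variable {V : Type*} {E : Type*} [DecidableEq E] {ends : E → Sym2 V} {z ℓ : V} {f : E}

/-- A leaf (in `ω`: every edge at `ℓ` other than `f` is closed) is isolated in `ω⁻`. -/
lemma leaf_not_mem_cluster_closeOne' {ω : Config E} (hω : ∀ e, ℓ ∈ ends e → e = f ∨ ω e = false)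
    {x : V} (hx : x ≠ ℓ) : ℓ ∉ cluster ends (Function.update ω f false) x := by
  intro hmem
  have hS : ∀ v ∈ {v : V | v ≠ ℓ}, ∀ y,
      (openGraph ends (Function.update ω f false)).Adj v y → y ∈ {v : V | v ≠ ℓ} := by
    intro v _ y hvy
    rw [openGraph_adj] at hvy
    obtain ⟨_, e, he, hends⟩ := hvy
    intro hy
    rw [hy] at hends
    have hl : ℓ ∈ ends e := by rw [hends]; exact Sym2.mem_mk_right _ _
    rcases hω e hl with hef | he0
    · subst hef; simp at he
    · by_cases hef : e = f
      · subst hef; simp at he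
      · rw [Function.update_of_ne hef] at he; rw [he0] at he; exact Bool.false_ne_true he
  exact (mem_of_conn_of_closed hS hx hmem) rfl

/-- **Pointwise cluster lemma**: `C(x) = C⁻(x) ∪ ({ℓ} if f open and z ∈ C⁻(x))` for `x ≠ ℓ`,
whenever every edge at `ℓ` other than `f` is closed in `ω`. -/
lemma cluster_leaf_eq' (hends : ends f = s(z, ℓ)) (hzℓ : z ≠ ℓ) {ω : Config E}
    (hω : ∀ e, ℓ ∈ ends e → e = f ∨ ω e = false) {x : V} (hx : x ≠ ℓ) :
    cluster ends ω x = cluster ends (Function.update ω f false) x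
      ∪ {u | u = ℓ ∧ ω f = true ∧ z ∈ cluster ends (Function.update ω f false) x} := by
  have hnot := leaf_not_mem_cluster_closeOne' hω hx
  ext u
  constructor
  · intro hu
    refine mem_of_conn_of_closed (S := cluster ends (Function.update ω f false) x
      ∪ {u | u = ℓ ∧ ω f = true ∧ z ∈ cluster ends (Function.update ω f false) x}) ?_
      (Or.inl (mem_cluster_self _ _ _)) hu
    intro v hv y hvy
    rw [openGraph_adj] at hvy
    obtain ⟨hne, e, he, hends'⟩ := hvy
    by_cases hef : e = f
    · subst hef
      rw [hends] at hends'
      rcases Sym2.eq_iff.1 hends' with ⟨hv', hy'⟩ | ⟨hv', hy'⟩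
      · subst hv'; subst hy'
        rcases hv with hv | ⟨hv, _⟩
        · exact Or.inr ⟨rfl, he, hv⟩
        · exact absurd hv hzℓ
      · subst hv'; subst hy'
        rcases hv with hv | ⟨_, _, hz⟩
        · exact absurd hv hnot
        · exact Or.inl hz
    · have he' : Function.update ω f false e = true := by
        rw [Function.update_of_ne hef]; exact he
      rcases hv with hv | ⟨hv, _, _⟩
      · exact Or.inl (mem_cluster_of_adj hv (openGraph_adj.2 ⟨hne, e, he', hends'⟩))
      · exfalso
        have hl : v ∈ ends e := by rw [hends']; exact Sym2.mem_mk_left _ _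
        rw [hv] at hl
        rcases hω e hl with h | h
        · exact hef h
        · rw [h] at he; exact Bool.false_ne_true he
  · rintro (hu | ⟨hu, hf, hz⟩)
    · exact cluster_mono (closeOne_le f ω) x hu
    · subst hu
      exact conn_trans (conn_mono (closeOne_le f ω) hz) (conn_of_openAdj ⟨f, hf, hends⟩)

/-- Pointwise: `{x ↔ y} = {x ↔ y in ω⁻}` for `x, y ≠ ℓ`. -/
lemma conn_leaf_iff_of_ne' (hends : ends f = s(z, ℓ)) (hzℓ : z ≠ ℓ) {ω : Config E}
    (hω : ∀ e, ℓ ∈ ends e → e = f ∨ ω e = false) {x y : V} (hx : x ≠ ℓ) (hy : y ≠ ℓ) :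
    Conn ends ω x y ↔ Conn ends (Function.update ω f false) x y := by
  have h := cluster_leaf_eq' hends hzℓ hω hx
  constructor
  · intro hc
    have : y ∈ cluster ends ω x := hc
    rw [h] at this
    rcases this with hmem | ⟨hyl, _⟩
    · exact hmem
    · exact absurd hyl hy
  · intro hc
    exact conn_mono (closeOne_le f ω) hc

/-- Pointwise: `{x ↔ ℓ} = {f open} ∩ {x ↔ z in ω⁻}` for `x ≠ ℓ`. -/
lemma conn_leaf_iff' (hends : ends f = s(z, ℓ)) (hzℓ : z ≠ ℓ) {ω : Config E}
    (hω : ∀ e, ℓ ∈ ends e → e = f ∨ ω e = false) {x : V} (hx : x ≠ ℓ) :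
    Conn ends ω x ℓ ↔ ω f = true ∧ Conn ends (Function.update ω f false) x z := by
  have h := cluster_leaf_eq' hends hzℓ hω hx
  have hnot := leaf_not_mem_cluster_closeOne' hω hx
  constructor
  · intro hc
    have : ℓ ∈ cluster ends ω x := hc
    rw [h] at this
    rcases this with hmem | ⟨_, hf, hz⟩
    · exact absurd hmem hnot
    · exact ⟨hf, hz⟩
  · rintro ⟨hf, hz⟩
    exact conn_trans (conn_mono (closeOne_le f ω) hz) (conn_of_openAdj ⟨f, hf, hends⟩)

omit [DecidableEq E] in
/-- Pointwise: a leaf whose edge is closed is its own cluster. -/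
lemma cluster_leaf_closed' {ω : Config E} (hω : ∀ e, ℓ ∈ ends e → e = f ∨ ω e = false)
    (hf : ω f = false) : cluster ends ω ℓ = {ℓ} := by
  apply Set.Subset.antisymm
  · intro u hu
    refine mem_of_conn_of_closed (S := {ℓ}) ?_ rfl hu
    intro v hv y hvy
    rw [openGraph_adj] at hvy
    obtain ⟨_, e, he, hends⟩ := hvy
    have hv' : v = ℓ := hv
    subst hv'
    have hl : v ∈ ends e := by rw [hends]; exact Sym2.mem_mk_left _ _
    rcases hω e hl with hef | he0
    · subst hef; rw [hf] at he; exact absurd he Bool.false_ne_true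
    · rw [he0] at he; exact absurd he Bool.false_ne_true
  · intro u hu
    have hu' : u = ℓ := hu
    subst hu'; exact mem_cluster_self _ _ _

end LeafPointwise

end Summit.Ventures.PercRepro2
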